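/-
Origin: written from primary sources — R. Howe, *θ-series and invariant theory* (1979) §3 (restriction of the oscillator
representation of the big pair to the see-saw partner is the tensor of the renormalised small ones); S. Kudla, *Seesaw dual
reductive pairs* (1984) §1; S. Gelbart, J. Rogawski, *L-functions and Fourier–Jacobi coefficients for the unitary group U(3)*
(1991) §3.1 Prop. 3.1.1 p. 455 (compatible splittings over unitary dual pairs), Remark p. 457 (normalisation by a character);
A. Weil, *Sur certains groupes d'opérateurs unitaires* (1964) Chap. III n° 41 p. 193. Adapted: no. This file SPECIALISES the
`(34)`-currency see-saw scheme of `UnitaryDualPairSeesawSchemeSmall` / `…SeesawThetaProduct` / `…SeesawWedgeKType` to the CM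
diagonal data of `UnitaryDualPairThetaKernelCM(Twist)` at the trivial conjugating isometry `g = 1`, `C = 1`, and absorbs the
normalising character `η` of `cmPairRepTwist` into the two line representations. Kernel only; no records.
-/
import Literature.NumberTheory.GelbartRogawski1991.UnitaryDualPairSeesawWedgeKType
import Literature.NumberTheory.GelbartRogawski1991.UnitaryDualPairSeesawThetaPeriod
import Literature.NumberTheory.GelbartRogawski1991.UnitaryDualPairThetaKernelCMTwist
import Literature.NumberTheory.Automorphic.UnitaryGroupAdelicLineTorus
import Literature.NumberTheory.Automorphic.UnitaryGroupAdelicOneTorus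
import HarnessLib

-- buildfix G11b-3 recipe (LEDGER B13-1/B13-3): elaborate sequentially so the trailing `attribute [implicit_reducible]`
-- block (reducibilityCoreExt is keyed to the async environment branch) is in force at `.olean` export.
set_option Elab.async false

/-!
# The see-saw restriction of the normalised CM pair representation to the diagonal torus `U(V) × (U(1) × U(1))`

Data: a CM field `L` (`L⁺ = maximalRealSubfield L`, `c = complexConj`), a diagonal hermitian space `V = diag(dV)` of rank `N`
and a diagonal hermitian PLANE `W = diag(a₀, a₁) = ⟨a₀⟩ ⊕ ⟨a₁⟩`; the big dual pair `(U(V), U(W))` with its chosen compatible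
splitting `s = splittingOf hGR` ([GelbartRogawski1991, Prop. 3.1.1]; `cmPairRep`, `cmPairRepTwist … η` of
`UnitaryDualPairThetaKernelCM(Twist)`), and the two small pairs `(U(V), U(⟨a_k⟩))` with chosen compatible splittings
`s_k = splittingOf hGR_k`.  Since `⟨a₀⟩ ⊕ᶠ ⟨a₁⟩ = diag(a₀, a₁)` ON THE NOSE (`finSum_diagonal_lineVec`), the `(34)`-currency
see-saw scheme of `UnitaryDualPairSeesawSchemeSmall` §ThirtyFour applies with the TRIVIAL conjugating isometry `g = 1` and Gram
intertwiner `C = 1` (`adelicIsometry_one_lineVec`, `gramIntertwiner_one_lineVec`), landing in `U(diag(a₀,a₁))(𝔸)` itself.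

* §1 the instantiation: `cmLineRepRaw₀/₁` = K-1's renormalised `seesawConjRep₁/₂` on `U(V)(𝔸) × U(⟨a_k⟩)(𝔸)`;
  `cmLineTensor` = `seesawConjTensor` (`𝒮(𝔸^{N×1}) ⊗ 𝒮(𝔸^{N×1}) → 𝒮(𝔸^n)`, bilinear); **`cmPairRep_blockDiag_cmLineTensor`** — the
  operator-level see-saw `ω_ψ(s_pair(v, u₀ ⊕ᶠ u₁)) (Φ₁ ⊗″ Φ₂) = (ω₀″(v,u₀) Φ₁) ⊗″ (ω₁″(v,u₁) Φ₂)` [Howe1979, §3; Kudla1984, §1]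
  and the theta product **`thetaDistLM_cmLineTensor`** `Θ(Φ₁ ⊗″ Φ₂) = Θ(Φ₁) Θ(Φ₂)`;
* §2 the torus `U(1) × U(1) ↪ U(diag(a₀,a₁))`, `(u₀,u₁) ↦ diag(u₀,u₁)` (`cmPlaneTorus`, through `adelicCenter` of the two lines)
  and the SPLIT of the normalising character `η(v, diag(u₀,u₁)) = η₀(v,u₀) · η₁(u₁)` (`cmEta₀`, `cmEta₁`, `cmEta_torus`);
* §3 the twisted line representations **`cmLineRep₀ η₀ = η₀ • ω₀″`, `cmLineRep₁ η₁ = η₁ • ω₁″`** on `U(V)(𝔸) × U(1)(𝔸)`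
  (PARAMETRIC in a split `η(v, diag(u₀,u₁)) = η₀(v,u₀) · η₁(v,u₁)` of the normalising character) and the
  see-saw restriction of the NORMALISED pair representation **`cmPairRepTwist_torus_cmLineTensor`**:
  `(ω_ψ ∘ (s_pair ⊗ η))(v, diag(u₀,u₁)) (Φ₁ ⊗″ Φ₂) = (cmLineRep₀ (v,u₀) Φ₁) ⊗″ (cmLineRep₁ (v,u₁) Φ₂)`
  [GelbartRogawski1991, §3.1 Remark p. 457; Howe1979, §3];
* §4 the same statements in the currencies `𝒮(𝔸^{n₁})` (re-indexed along `e₁`) and `ker N_{L/L⁺} ≤ 𝔸_L^×`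
  (`cmLineTensorFin`, `cmLineRepFin₀/₁`, `cmPlaneTorusIdeles`, **`cmPairRepTwist_torusIdeles_cmLineTensorFin`**,
  **`thetaDistLM_cmLineTensorFin`**);
* §5 rational points act inside the theta stabiliser (`cmLineRepRaw₀/₁_toHomUnits_mem_thetaStabilizer`);
* §6 the junction with the `adelicUnitaryGroup` currency of the period packet's torus embedding `t ↦ diag(t₀, t₁) ∈ U(diag a)(𝔸)`:
  **`cmAdelicEquiv_eq_cmPlaneTorusIdeles`** (an element of `U(diag a)(𝔸_{L⁺})` with matrix `diag(t₀, t₁)` is carried by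
  `cmAdelicEquiv` to `cmPlaneTorusIdeles (t₀, t₁)`), so that §4 applies verbatim to such elements
  (**`cmPairRepTwist_cmAdelicEquiv_cmLineTensorFin`**).

Provenance / use (Hodge-CM model-construction cell, row `S` of the binder ledger, (S-restr)/(x-S)): the S-side line
representations `((S V c).P k).ω`, `k = 0, 1`, of the Hodge-CM period packet are `cmLineRepFin₀/₁` pulled back to
`U_V(𝔸) × ker N_{L/L⁺}` (`N = 3`, `n₁ = 3`, `n = 6`); binder-1's `SeesawCore.ofOp` hypothesis `op` is
`cmPairRepTwist_torusIdeles_cmLineTensorFin`, `prod` is `thetaDistLM_cmLineTensorFin`.  Nothing here is a claim of the manuscripts under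
adjudication; the three `CompatibleSplitting` hypotheses are [GelbartRogawski1991, Prop. 3.1.1] verbatim.
-/

set_option autoImplicit false

noncomputable section

open scoped Matrix Kronecker
open NumberField
open Literature.RepresentationTheory Literature.RepresentationTheory.SeesawScalar
open Literature.NumberTheory.Automorphic
open Literature.NumberTheory.Automorphic.UnitaryGroup
open Literature.NumberTheory.Weil1964

namespace Literature.NumberTheory.GelbartRogawski1991

namespace UnitaryDualPair

/-! ## §0. A hermitian plane is the direct sum of its two lines ON THE NOSE: `g = 1`, `C = 1` -/

section Plane

variable (L : Type) [Field L] [NumberField L] [IsCMField L]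

/-- the diagonal vector `(x)` of the hermitian LINE `⟨x⟩` (its Gram matrix in the CM currency is `Matrix.diagonal (lineVec x)`).
[folklore] -/
abbrev lineVec (x : L) : Fin 1 → L := fun _ => x

omit [NumberField L] [IsCMField L] in
/-- `⟨a₀⟩ ⊕ᶠ ⟨a₁⟩ = diag(a₀, a₁)` over `L`. [folklore] -/
theorem finSum_diagonal_lineVec (a : Fin 2 → L) :
    (finSum 1 1 (Matrix.diagonal (lineVec L (a 0))) (Matrix.diagonal (lineVec L (a 1))) :
      Matrix (Fin (1 + 1)) (Fin (1 + 1)) L) = Matrix.diagonal a := by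
  ext i k; fin_cases i <;> fin_cases k <;> rfl

/-- `⟨a₀⟩ ⊕ᶠ ⟨a₁⟩ = diag(a₀, a₁)` for the real Gram matrices over `L⁺`. [folklore] -/
theorem finSum_realDiagonal_lineVec (a : Fin 2 → L) (ha : ∀ i, IsCMField.complexConj L (a i) = a i) :
    (finSum 1 1 (realDiagonal L (lineVec L (a 0)) fun _ => ha 0) (realDiagonal L (lineVec L (a 1)) fun _ => ha 1) :
      Matrix (Fin (1 + 1)) (Fin (1 + 1)) ↥(maximalRealSubfield L)) = realDiagonal L a ha := by
  ext i k; fin_cases i <;> fin_cases k <;> rfl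

omit [NumberField L] [IsCMField L] in
/-- the identity of `GL` is a rational point: `1 = 1.map (algebraMap R S)`. [folklore] -/
theorem coe_one_GL_eq_map (R S : Type*) [CommRing R] [CommRing S] [Algebra R S] (m : Type*) [Fintype m]
    [DecidableEq m] :
    (((1 : GL m S)) : Matrix m m S) = (((1 : GL m R)) : Matrix m m R).map (algebraMap R S) := by
  rw [Units.val_one, Units.val_one, Matrix.map_one _ (map_zero _) (map_one _)]

variable (a : Fin 2 → L) (ha : ∀ i, IsCMField.complexConj L (a i) = a i)

/-- `g = 1` is an adelic isometry `(W ⊗ 𝔸, ⟨a₀⟩ ⊕ᶠ ⟨a₁⟩) ≅ (W ⊗ 𝔸, diag(a₀, a₁))` (hypothesis `hg` of the `(34)` scheme).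
[folklore] -/
theorem adelicIsometry_one_lineVec :
    (((1 : GL (Fin (1 + 1)) (AdeleRing (𝓞 L) L)) : Matrix (Fin (1 + 1)) (Fin (1 + 1)) (AdeleRing (𝓞 L) L)).map
          (conjAdele (↥(maximalRealSubfield L)) L (IsCMField.complexConj L)))ᵀ *
        adelicForm L (1 + 1) (Matrix.diagonal a) *
        ((1 : GL (Fin (1 + 1)) (AdeleRing (𝓞 L) L)) : Matrix (Fin (1 + 1)) (Fin (1 + 1)) (AdeleRing (𝓞 L) L)) =
      adelicForm L (1 + 1) (finSum 1 1 (Matrix.diagonal (lineVec L (a 0))) (Matrix.diagonal (lineVec L (a 1)))) := by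
  rw [finSum_diagonal_lineVec, Units.val_one, Matrix.map_one _ (map_zero _) (map_one _), Matrix.transpose_one,
    one_mul, mul_one]

/-- `C = 1` intertwines the Gram matrices `T_V ⊗ diag(a) ⊗ 1` and `T_V ⊗ (⟨a₀⟩ ⊕ᶠ ⟨a₁⟩) ⊗ 1` (hypothesis `hC` of the `(34)`
scheme). [folklore] -/
theorem gramIntertwiner_one_lineVec {N : ℕ} (TV : Matrix (Fin N) (Fin N) ↥(maximalRealSubfield L)) :
    TV.map (algebraMap (↥(maximalRealSubfield L)) (AdeleRing (𝓞 ↥(maximalRealSubfield L)) ↥(maximalRealSubfield L))) ⊗ₖ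
          (realDiagonal L a ha).map
            (algebraMap (↥(maximalRealSubfield L)) (AdeleRing (𝓞 ↥(maximalRealSubfield L)) ↥(maximalRealSubfield L))) *
        ((1 : GL (Fin N × Fin (1 + 1)) (AdeleRing (𝓞 ↥(maximalRealSubfield L)) ↥(maximalRealSubfield L))) :
          Matrix (Fin N × Fin (1 + 1)) (Fin N × Fin (1 + 1))
            (AdeleRing (𝓞 ↥(maximalRealSubfield L)) ↥(maximalRealSubfield L))) =
      TV.map (algebraMap (↥(maximalRealSubfield L)) (AdeleRing (𝓞 ↥(maximalRealSubfield L)) ↥(maximalRealSubfield L))) ⊗ₖ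
        (finSum 1 1 (realDiagonal L (lineVec L (a 0)) fun _ => ha 0)
            (realDiagonal L (lineVec L (a 1)) fun _ => ha 1)).map
          (algebraMap (↥(maximalRealSubfield L)) (AdeleRing (𝓞 ↥(maximalRealSubfield L)) ↥(maximalRealSubfield L))) := by
  rw [finSum_realDiagonal_lineVec, Units.val_one, mul_one]

end Plane

/-! ## §1. K-1's `(34)`-currency line representations and see-saw tensor at the CM data, `g = 1`, `C = 1` -/

section Raw

variable (L : Type) [Field L] [NumberField L] [IsCMField L] {N n n₁ : ℕ}
  (e : Fin N × Fin 2 ≃ Fin n) (e₁ : Fin N × Fin 1 ≃ Fin n₁)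
variable (dV : Fin N → L) (hdV : ∀ i, IsCMField.complexConj L (dV i) = dV i) (hdV0 : ∀ i, dV i ≠ 0)
variable (a : Fin 2 → L) (ha : ∀ i, IsCMField.complexConj L (a i) = a i) (ha0 : ∀ i, a i ≠ 0)
variable (hGR : (cmSplittingDatum L e dV hdV hdV0 a ha ha0).CompatibleSplitting)
  (hGR₀ : (cmSplittingDatum L e₁ dV hdV hdV0 (lineVec L (a 0)) (fun _ => ha 0) (fun _ => ha0 0)).CompatibleSplitting)
  (hGR₁ : (cmSplittingDatum L e₁ dV hdV hdV0 (lineVec L (a 1)) (fun _ => ha 1) (fun _ => ha0 1)).CompatibleSplitting)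

/-- **`ω₀″`**: K-1's renormalised `(34)`-currency line representation `seesawConjRep₁` of `U(diag dV)(𝔸) × U(⟨a₀⟩)(𝔸)` on
`𝒮(𝔸_{L⁺}^{N × 1})`, at the CM data, `g = 1`, `C = 1`, splittings `splittingOf hGR, splittingOf hGR₀, splittingOf hGR₁`.
[cite: Howe1979, §3] -/
def cmLineRepRaw₀ :
    Representation ℂ (CMAdelic L dV × CMAdelic L (lineVec L (a 0)))
      (piSchwartzBruhat (↥(maximalRealSubfield L)) (Fin N × Fin 1)) :=
  seesawConjRep₁ (↥(maximalRealSubfield L)) L (IsCMField.complexConj L) N 1 1 e e₁ e₁ (Matrix.diagonal dV)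
    (Matrix.diagonal a) (Matrix.diagonal (lineVec L (a 0))) (Matrix.diagonal (lineVec L (a 1)))
    (complexConj_imagUnit L) (imagUnit_ne_zero L) (imagUnit_mul_self L)
    (realDiagonal_isSymm L dV hdV) (realDiagonal_isSymm L a ha)
    (realDiagonal_isSymm L (lineVec L (a 0)) fun _ => ha 0) (realDiagonal_isSymm L (lineVec L (a 1)) fun _ => ha 1)
    (isUnit_det_realDiagonal L dV hdV hdV0) (isUnit_det_realDiagonal L a ha ha0)
    (isUnit_det_realDiagonal L (lineVec L (a 0)) (fun _ => ha 0) fun _ => ha0 0)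
    (isUnit_det_realDiagonal L (lineVec L (a 1)) (fun _ => ha 1) fun _ => ha0 1)
    ((Matrix.isUnit_iff_isUnit_det _).1
      (isUnit_kronecker_map (↥(maximalRealSubfield L)) N (isUnit_det_realDiagonal L dV hdV hdV0)
        (isUnit_det_realDiagonal L a ha ha0)))
    (realDiagonal_map L dV hdV).symm (realDiagonal_map L a ha).symm
    (realDiagonal_map L (lineVec L (a 0)) fun _ => ha 0).symm (realDiagonal_map L (lineVec L (a 1)) fun _ => ha 1).symm
    (coe_one_GL_eq_map L (AdeleRing (𝓞 L) L) (Fin (1 + 1))) (adelicIsometry_one_lineVec L a)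
    (coe_one_GL_eq_map (↥(maximalRealSubfield L)) (AdeleRing (𝓞 ↥(maximalRealSubfield L)) ↥(maximalRealSubfield L))
      (Fin N × Fin (1 + 1)))
    (gramIntertwiner_one_lineVec L a ha (realDiagonal L dV hdV))
    (splittingOf_isCompatible _ _ _ _ _ _ _ _ _ _ _ _ _ _ _ _ _ hGR)
    (splittingOf_isCompatible _ _ _ _ _ _ _ _ _ _ _ _ _ _ _ _ _ hGR₀)
    (splittingOf_isCompatible _ _ _ _ _ _ _ _ _ _ _ _ _ _ _ _ _ hGR₁)

/-- **`ω₁″`**: K-1's renormalised `(34)`-currency line representation `seesawConjRep₂` of `U(diag dV)(𝔸) × U(⟨a₁⟩)(𝔸)` on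
`𝒮(𝔸_{L⁺}^{N × 1})`, at the CM data, `g = 1`, `C = 1`. [cite: Howe1979, §3] -/
def cmLineRepRaw₁ :
    Representation ℂ (CMAdelic L dV × CMAdelic L (lineVec L (a 1)))
      (piSchwartzBruhat (↥(maximalRealSubfield L)) (Fin N × Fin 1)) :=
  seesawConjRep₂ (↥(maximalRealSubfield L)) L (IsCMField.complexConj L) N 1 1 e e₁ e₁ (Matrix.diagonal dV)
    (Matrix.diagonal a) (Matrix.diagonal (lineVec L (a 0))) (Matrix.diagonal (lineVec L (a 1)))
    (complexConj_imagUnit L) (imagUnit_ne_zero L) (imagUnit_mul_self L)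
    (realDiagonal_isSymm L dV hdV) (realDiagonal_isSymm L a ha)
    (realDiagonal_isSymm L (lineVec L (a 0)) fun _ => ha 0) (realDiagonal_isSymm L (lineVec L (a 1)) fun _ => ha 1)
    (isUnit_det_realDiagonal L dV hdV hdV0) (isUnit_det_realDiagonal L a ha ha0)
    (isUnit_det_realDiagonal L (lineVec L (a 0)) (fun _ => ha 0) fun _ => ha0 0)
    (isUnit_det_realDiagonal L (lineVec L (a 1)) (fun _ => ha 1) fun _ => ha0 1)
    ((Matrix.isUnit_iff_isUnit_det _).1
      (isUnit_kronecker_map (↥(maximalRealSubfield L)) N (isUnit_det_realDiagonal L dV hdV hdV0)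
        (isUnit_det_realDiagonal L a ha ha0)))
    (realDiagonal_map L dV hdV).symm (realDiagonal_map L a ha).symm
    (realDiagonal_map L (lineVec L (a 0)) fun _ => ha 0).symm (realDiagonal_map L (lineVec L (a 1)) fun _ => ha 1).symm
    (coe_one_GL_eq_map L (AdeleRing (𝓞 L) L) (Fin (1 + 1))) (adelicIsometry_one_lineVec L a)
    (coe_one_GL_eq_map (↥(maximalRealSubfield L)) (AdeleRing (𝓞 ↥(maximalRealSubfield L)) ↥(maximalRealSubfield L))
      (Fin N × Fin (1 + 1)))
    (gramIntertwiner_one_lineVec L a ha (realDiagonal L dV hdV))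
    (splittingOf_isCompatible _ _ _ _ _ _ _ _ _ _ _ _ _ _ _ _ _ hGR)
    (splittingOf_isCompatible _ _ _ _ _ _ _ _ _ _ _ _ _ _ _ _ _ hGR₀)
    (splittingOf_isCompatible _ _ _ _ _ _ _ _ _ _ _ _ _ _ _ _ _ hGR₁)

/-- **`⊗″ = cmLineTensor`**: the pure tensor of two small test functions read in the big pair `(U(diag dV), U(diag a))`'s
Schrödinger model of record `𝒮(𝔸^n)` through the see-saw element (`seesawConjTensor` at the CM data, `g = 1`, `C = 1`;
bilinear). [folklore] -/
def cmLineTensor :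
    piSchwartzBruhat (↥(maximalRealSubfield L)) (Fin N × Fin 1) →ₗ[ℂ]
      piSchwartzBruhat (↥(maximalRealSubfield L)) (Fin N × Fin 1) →ₗ[ℂ]
        piSchwartzBruhat (↥(maximalRealSubfield L)) (Fin n) :=
  seesawConjTensor (↥(maximalRealSubfield L)) L (IsCMField.complexConj L) N 1 1 e (Matrix.diagonal dV)
    (Matrix.diagonal a) (Matrix.diagonal (lineVec L (a 0))) (Matrix.diagonal (lineVec L (a 1)))
    (complexConj_imagUnit L) (imagUnit_ne_zero L) (imagUnit_mul_self L)
    (realDiagonal_isSymm L dV hdV) (realDiagonal_isSymm L a ha)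
    (realDiagonal_isSymm L (lineVec L (a 0)) fun _ => ha 0) (realDiagonal_isSymm L (lineVec L (a 1)) fun _ => ha 1)
    (isUnit_det_realDiagonal L dV hdV hdV0) (isUnit_det_realDiagonal L a ha ha0)
    ((Matrix.isUnit_iff_isUnit_det _).1
      (isUnit_kronecker_map (↥(maximalRealSubfield L)) N (isUnit_det_realDiagonal L dV hdV hdV0)
        (isUnit_det_realDiagonal L a ha ha0)))
    (realDiagonal_map L dV hdV).symm (realDiagonal_map L a ha).symm
    (realDiagonal_map L (lineVec L (a 0)) fun _ => ha 0).symm (realDiagonal_map L (lineVec L (a 1)) fun _ => ha 1).symm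
    (coe_one_GL_eq_map L (AdeleRing (𝓞 L) L) (Fin (1 + 1))) (adelicIsometry_one_lineVec L a)
    (coe_one_GL_eq_map (↥(maximalRealSubfield L)) (AdeleRing (𝓞 ↥(maximalRealSubfield L)) ↥(maximalRealSubfield L))
      (Fin N × Fin (1 + 1)))
    (gramIntertwiner_one_lineVec L a ha (realDiagonal L dV hdV))

/-- **the plane's torus element `u₀ ⊕ᶠ u₁ ∈ U(diag(a₀,a₁))(𝔸)`** of a pair `(u₀, u₁) ∈ U(⟨a₀⟩)(𝔸) × U(⟨a₁⟩)(𝔸)`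
(`adelicBlockDiag` conjugated by `g = 1`). [cite: Kudla1984, §1] -/
def cmPlaneBlockDiag : CMAdelic L (lineVec L (a 0)) × CMAdelic L (lineVec L (a 1)) →* CMAdelic L a :=
  (adelicIsometryConj (↥(maximalRealSubfield L)) L (IsCMField.complexConj L) (1 + 1) 1
      (adelicIsometry_one_lineVec L a)).comp
    (adelicBlockDiag (↥(maximalRealSubfield L)) L (IsCMField.complexConj L) 1 1 (Matrix.diagonal (lineVec L (a 0)))
      (Matrix.diagonal (lineVec L (a 1))))

set_option maxHeartbeats 800000 in
/-- **THE SEE-SAW RESTRICTION AT OPERATOR LEVEL for the CM pair representation `ω_ψ ∘ s_pair`** along the plane's torus: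
`ω_ψ(s_pair(v, u₀ ⊕ᶠ u₁)) (Φ₁ ⊗″ Φ₂) = (ω₀″(v,u₀) Φ₁) ⊗″ (ω₁″(v,u₁) Φ₂)` (`pairRep_isometryConj_seesawConjTensor` at the CM data).
[cite: Howe1979, §3] -/
theorem cmPairRep_blockDiag_cmLineTensor (v : CMAdelic L dV) (u₀ : CMAdelic L (lineVec L (a 0)))
    (u₁ : CMAdelic L (lineVec L (a 1))) (Φ₁ Φ₂ : piSchwartzBruhat (↥(maximalRealSubfield L)) (Fin N × Fin 1)) :
    cmPairRep L e dV hdV hdV0 a ha ha0 hGR (v, cmPlaneBlockDiag L a (u₀, u₁))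
        (cmLineTensor L e dV hdV hdV0 a ha ha0 Φ₁ Φ₂) =
      cmLineTensor L e dV hdV hdV0 a ha ha0 (cmLineRepRaw₀ L e e₁ dV hdV hdV0 a ha ha0 hGR hGR₀ hGR₁ (v, u₀) Φ₁)
        (cmLineRepRaw₁ L e e₁ dV hdV hdV0 a ha ha0 hGR hGR₀ hGR₁ (v, u₁) Φ₂) :=
  pairRep_isometryConj_seesawConjTensor (↥(maximalRealSubfield L)) L (IsCMField.complexConj L) N 1 1 e e₁ e₁
    (Matrix.diagonal dV) (Matrix.diagonal a) (Matrix.diagonal (lineVec L (a 0))) (Matrix.diagonal (lineVec L (a 1)))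
    (complexConj_imagUnit L) (imagUnit_ne_zero L) (imagUnit_mul_self L)
    (realDiagonal_isSymm L dV hdV) (realDiagonal_isSymm L a ha)
    (realDiagonal_isSymm L (lineVec L (a 0)) fun _ => ha 0) (realDiagonal_isSymm L (lineVec L (a 1)) fun _ => ha 1)
    (isUnit_det_realDiagonal L dV hdV hdV0) (isUnit_det_realDiagonal L a ha ha0)
    (isUnit_det_realDiagonal L (lineVec L (a 0)) (fun _ => ha 0) fun _ => ha0 0)
    (isUnit_det_realDiagonal L (lineVec L (a 1)) (fun _ => ha 1) fun _ => ha0 1)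
    ((Matrix.isUnit_iff_isUnit_det _).1
      (isUnit_kronecker_map (↥(maximalRealSubfield L)) N (isUnit_det_realDiagonal L dV hdV hdV0)
        (isUnit_det_realDiagonal L a ha ha0)))
    (realDiagonal_map L dV hdV).symm (realDiagonal_map L a ha).symm
    (realDiagonal_map L (lineVec L (a 0)) fun _ => ha 0).symm (realDiagonal_map L (lineVec L (a 1)) fun _ => ha 1).symm
    (coe_one_GL_eq_map L (AdeleRing (𝓞 L) L) (Fin (1 + 1))) (adelicIsometry_one_lineVec L a)
    (coe_one_GL_eq_map (↥(maximalRealSubfield L)) (AdeleRing (𝓞 ↥(maximalRealSubfield L)) ↥(maximalRealSubfield L))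
      (Fin N × Fin (1 + 1)))
    (gramIntertwiner_one_lineVec L a ha (realDiagonal L dV hdV))
    (splittingOf_isCompatible _ _ _ _ _ _ _ _ _ _ _ _ _ _ _ _ _ hGR)
    (splittingOf_isCompatible _ _ _ _ _ _ _ _ _ _ _ _ _ _ _ _ _ hGR₀)
    (splittingOf_isCompatible _ _ _ _ _ _ _ _ _ _ _ _ _ _ _ _ _ hGR₁) v u₀ u₁ Φ₁ Φ₂

/-- **the theta functional is multiplicative on `⊗″`**: `Θ(Φ₁ ⊗″ Φ₂) = Θ(Φ₁) · Θ(Φ₂)` — `Θ` is invariant under the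
re-indexings `R_{e_W}`, `R_f` and under `ω(r_F h₀)` for the RATIONAL see-saw element `h₀` (Weil's Théorème 6), and multiplicative
on `Φ₁ ⊠ Φ₂` (`thetaDistLM_tensorToSum`). [cite: Weil1964, Chap. III n° 41 Thm 6 p. 193] -/
theorem thetaDistLM_cmLineTensor (Φ₁ Φ₂ : piSchwartzBruhat (↥(maximalRealSubfield L)) (Fin N × Fin 1)) :
    thetaDistLM (↥(maximalRealSubfield L)) (Fin n) (cmLineTensor L e dV hdV hdV0 a ha ha0 Φ₁ Φ₂) =
      thetaDistLM (↥(maximalRealSubfield L)) (Fin N × Fin 1) Φ₁ *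
        thetaDistLM (↥(maximalRealSubfield L)) (Fin N × Fin 1) Φ₂ := by
  rw [cmLineTensor, seesawConjTensor_apply, thetaDistLM_piSBReindex, thetaDistLM_apply,
    thetaDist_omega_ratPointsThetaLiftCont, ← thetaDistLM_apply, piSBReindex_symm, thetaDistLM_piSBReindex,
    thetaDistLM_tensorToSum]

end Raw

/-! ## §2. The diagonal torus `U(1) × U(1) ↪ U(diag(a₀,a₁))` and the split of the normalising character `η` -/

section Torus

variable (L : Type) [Field L] [NumberField L] [IsCMField L] {N : ℕ} (dV : Fin N → L)
variable (a : Fin 2 → L)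

/-- **the plane's diagonal torus** `(u₀, u₁) ↦ u₀ ⊕ᶠ u₁ = diag(u₀, u₁) : U(1)(𝔸) × U(1)(𝔸) →* U(diag(a₀,a₁))(𝔸)` (through the
centres of the two lines, `cmPlaneBlockDiag ∘ (adelicCenter × adelicCenter)`). [cite: Kudla1984, §1] -/
def cmPlaneTorus : CMAdelicOne L × CMAdelicOne L →* CMAdelic L a :=
  (cmPlaneBlockDiag L a).comp ((CMCenter L (lineVec L (a 0))).prodMap (CMCenter L (lineVec L (a 1))))

/-- unfolding. [folklore] -/
theorem cmPlaneTorus_apply (u₀ u₁ : CMAdelicOne L) :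
    cmPlaneTorus L a (u₀, u₁) = cmPlaneBlockDiag L a (CMCenter L (lineVec L (a 0)) u₀, CMCenter L (lineVec L (a 1)) u₁) :=
  rfl

/-- in `GL₂(𝔸_L)` the torus element is the block-diagonal of the two central line elements (`g = 1`). [folklore] -/
theorem coe_cmPlaneTorus (u₀ u₁ : CMAdelicOne L) :
    ((cmPlaneTorus L a (u₀, u₁) : CMAdelic L a) : GL (Fin (1 + 1)) (AdeleRing (𝓞 L) L)) =
      (adelicBlockDiag (↥(maximalRealSubfield L)) L (IsCMField.complexConj L) 1 1 (Matrix.diagonal (lineVec L (a 0)))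
          (Matrix.diagonal (lineVec L (a 1))) (CMCenter L (lineVec L (a 0)) u₀, CMCenter L (lineVec L (a 1)) u₁) :
        adelic (↥(maximalRealSubfield L)) L (IsCMField.complexConj L) (1 + 1)
          (finSum 1 1 (Matrix.diagonal (lineVec L (a 0))) (Matrix.diagonal (lineVec L (a 1))))) := by
  change (1 : GL (Fin (1 + 1)) (AdeleRing (𝓞 L) L)) * _ * 1⁻¹ = _
  rw [inv_one, mul_one, one_mul]
  rfl

/-- **the torus is diagonal**: the matrix of `cmPlaneTorus (u₀, u₁)` is `diagonal ![u₀, u₁]`. [cite: Kudla1984, §1] -/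
theorem val_cmPlaneTorus (u₀ u₁ : CMAdelicOne L) :
    (((cmPlaneTorus L a (u₀, u₁) : CMAdelic L a) : GL (Fin (1 + 1)) (AdeleRing (𝓞 L) L)) :
        Matrix (Fin (1 + 1)) (Fin (1 + 1)) (AdeleRing (𝓞 L) L)) =
      Matrix.diagonal ![((u₀ : (AdeleRing (𝓞 L) L)ˣ) : AdeleRing (𝓞 L) L), ((u₁ : (AdeleRing (𝓞 L) L)ˣ) : AdeleRing (𝓞 L) L)] := by
  rw [coe_cmPlaneTorus]
  exact coe_adelicBlockDiag_adelicCenter _ _ _ _ _ u₀ u₁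

/-- the first factor `u ↦ u ⊕ᶠ 1 = diag(u, 1)` of the torus. [folklore] -/
def cmPlaneTorusInl : CMAdelicOne L →* CMAdelic L a := (cmPlaneTorus L a).comp (MonoidHom.inl _ _)

/-- the second factor `u ↦ 1 ⊕ᶠ u = diag(1, u)` of the torus. [folklore] -/
def cmPlaneTorusInr : CMAdelicOne L →* CMAdelic L a := (cmPlaneTorus L a).comp (MonoidHom.inr _ _)

/-- `diag(u₀, u₁) = diag(u₀, 1) · diag(1, u₁)`. [folklore] -/
theorem cmPlaneTorus_eq_inl_mul_inr (u₀ u₁ : CMAdelicOne L) :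
    cmPlaneTorus L a (u₀, u₁) = cmPlaneTorusInl L a u₀ * cmPlaneTorusInr L a u₁ := by
  rw [cmPlaneTorusInl, cmPlaneTorusInr, MonoidHom.comp_apply, MonoidHom.comp_apply, ← map_mul, MonoidHom.inl_apply,
    MonoidHom.inr_apply, Prod.mk_mul_mk, mul_one, one_mul]

variable (η : CMAdelic L dV × CMAdelic L a →* ℂˣ)

/-- **`η₀(v, u) := η(v, diag(u, 1))`**, the part of the normalising character carried by the first line. [folklore] -/
def cmEta₀ : CMAdelic L dV × CMAdelicOne L →* ℂˣ := η.comp ((MonoidHom.id _).prodMap (cmPlaneTorusInl L a))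

/-- **`η₁(u) := η(1, diag(1, u))`**, the part of the normalising character carried by the second line. [folklore] -/
def cmEta₁ : CMAdelicOne L →* ℂˣ := η.comp ((MonoidHom.inr _ _).comp (cmPlaneTorusInr L a))

/-- **the split of `η` along the torus**: `η(v, diag(u₀, u₁)) = η₀(v, u₀) · η₁(u₁)`. [folklore] -/
theorem cmEta_torus (v : CMAdelic L dV) (u₀ u₁ : CMAdelicOne L) :
    η (v, cmPlaneTorus L a (u₀, u₁)) = cmEta₀ L dV a η (v, u₀) * cmEta₁ L dV a η u₁ := by
  change η (v, cmPlaneTorus L a (u₀, u₁)) = η (v, cmPlaneTorusInl L a u₀) * η (1, cmPlaneTorusInr L a u₁)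
  rw [← map_mul, Prod.mk_mul_mk, mul_one, cmPlaneTorus_eq_inl_mul_inr]

end Torus

/-! ## §3. The twisted line representations and the see-saw restriction of the NORMALISED pair representation

The normalising character `η` of `U(V)(𝔸) × U(W)(𝔸)` restricted to `U(V) × (U(1) × U(1))` is distributed over the two
lines by ANY pair of characters `η₀, η₁` of `U(V)(𝔸) × U(1)(𝔸)` with `η(v, diag(u₀,u₁)) = η₀(v,u₀) · η₁(v,u₁)` (hypothesis
`hη` below; the restriction identity is bilinear in the two scalars, so every split is admissible). The DEFAULT split
`η₀ := cmEta₀ η`, `η₁ := cmEta₁ η ∘ snd` (`cmEta_torus`) is one instance (`cmPairRepTwist_torus_cmLineTensor_default`). -/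

section Lines

variable (L : Type) [Field L] [NumberField L] [IsCMField L] {N n n₁ : ℕ}
  (e : Fin N × Fin 2 ≃ Fin n) (e₁ : Fin N × Fin 1 ≃ Fin n₁)
variable (dV : Fin N → L) (hdV : ∀ i, IsCMField.complexConj L (dV i) = dV i) (hdV0 : ∀ i, dV i ≠ 0)
variable (a : Fin 2 → L) (ha : ∀ i, IsCMField.complexConj L (a i) = a i) (ha0 : ∀ i, a i ≠ 0)
variable (hGR : (cmSplittingDatum L e dV hdV hdV0 a ha ha0).CompatibleSplitting)
  (hGR₀ : (cmSplittingDatum L e₁ dV hdV hdV0 (lineVec L (a 0)) (fun _ => ha 0) (fun _ => ha0 0)).CompatibleSplitting)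
  (hGR₁ : (cmSplittingDatum L e₁ dV hdV hdV0 (lineVec L (a 1)) (fun _ => ha 1) (fun _ => ha0 1)).CompatibleSplitting)
  (η : CMAdelic L dV × CMAdelic L a →* ℂˣ) (η₀ η₁ : CMAdelic L dV × CMAdelicOne L →* ℂˣ)

/-- **`cmLineRep₀ = η₀ • ω₀″`**: the line representation of `U(diag dV)(𝔸) × U(1)(𝔸)` on `𝒮(𝔸_{L⁺}^{N × 1})` attached to
the first line `⟨a₀⟩` — K-1's renormalised `(34)` representation pulled back along the centre `u ↦ u · 1` and twisted by a
character `η₀`. [cite: GelbartRogawski1991, §3.1 Remark p. 457 L4–13] -/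
def cmLineRep₀ :
    Representation ℂ (CMAdelic L dV × CMAdelicOne L) (piSchwartzBruhat (↥(maximalRealSubfield L)) (Fin N × Fin 1)) :=
  twist η₀
    ((cmLineRepRaw₀ L e e₁ dV hdV hdV0 a ha ha0 hGR hGR₀ hGR₁).comp
      ((MonoidHom.id _).prodMap (CMCenter L (lineVec L (a 0)))))

/-- **`cmLineRep₁ = η₁ • ω₁″`**: the line representation attached to the second line `⟨a₁⟩`, twisted by `η₁`.
[cite: GelbartRogawski1991, §3.1 Remark p. 457 L4–13] -/
def cmLineRep₁ :
    Representation ℂ (CMAdelic L dV × CMAdelicOne L) (piSchwartzBruhat (↥(maximalRealSubfield L)) (Fin N × Fin 1)) :=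
  twist η₁
    ((cmLineRepRaw₁ L e e₁ dV hdV hdV0 a ha ha0 hGR hGR₀ hGR₁).comp
      ((MonoidHom.id _).prodMap (CMCenter L (lineVec L (a 1)))))

/-- values of `cmLineRep₀`. [folklore] -/
theorem cmLineRep₀_apply (v : CMAdelic L dV) (u : CMAdelicOne L)
    (Φ : piSchwartzBruhat (↥(maximalRealSubfield L)) (Fin N × Fin 1)) :
    cmLineRep₀ L e e₁ dV hdV hdV0 a ha ha0 hGR hGR₀ hGR₁ η₀ (v, u) Φ =
      ((η₀ (v, u) : ℂˣ) : ℂ) • cmLineRepRaw₀ L e e₁ dV hdV hdV0 a ha ha0 hGR hGR₀ hGR₁ (v, CMCenter L (lineVec L (a 0)) u) Φ :=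
  rfl

/-- values of `cmLineRep₁`. [folklore] -/
theorem cmLineRep₁_apply (v : CMAdelic L dV) (u : CMAdelicOne L)
    (Φ : piSchwartzBruhat (↥(maximalRealSubfield L)) (Fin N × Fin 1)) :
    cmLineRep₁ L e e₁ dV hdV hdV0 a ha ha0 hGR hGR₀ hGR₁ η₁ (v, u) Φ =
      ((η₁ (v, u) : ℂˣ) : ℂ) • cmLineRepRaw₁ L e e₁ dV hdV hdV0 a ha ha0 hGR hGR₀ hGR₁ (v, CMCenter L (lineVec L (a 1)) u) Φ :=
  rfl

/-- **THE SEE-SAW RESTRICTION OF THE NORMALISED CM PAIR REPRESENTATION `ω_ψ ∘ (s_pair ⊗ η)` TO THE DIAGONAL TORUS**: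
for every split `η(v, diag(u₀,u₁)) = η₀(v,u₀) · η₁(v,u₁)`, all `v ∈ U(diag dV)(𝔸)`, `u₀, u₁ ∈ U(1)(𝔸)` and small test
functions `Φ₁, Φ₂`,
`(ω_ψ ∘ (s_pair ⊗ η))(v, diag(u₀, u₁)) (Φ₁ ⊗″ Φ₂) = (cmLineRep₀ η₀ (v, u₀) Φ₁) ⊗″ (cmLineRep₁ η₁ (v, u₁) Φ₂)` — the operator
`op` of the Hodge-CM period packet's `SeesawCore.ofOp`. [cite: Howe1979, §3; GelbartRogawski1991, §3.1 Remark p. 457 L4–13] -/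
theorem cmPairRepTwist_torus_cmLineTensor
    (hη : ∀ (v : CMAdelic L dV) (u₀ u₁ : CMAdelicOne L), η (v, cmPlaneTorus L a (u₀, u₁)) = η₀ (v, u₀) * η₁ (v, u₁))
    (v : CMAdelic L dV) (u₀ u₁ : CMAdelicOne L) (Φ₁ Φ₂ : piSchwartzBruhat (↥(maximalRealSubfield L)) (Fin N × Fin 1)) :
    cmPairRepTwist L e dV hdV hdV0 a ha ha0 hGR η (v, cmPlaneTorus L a (u₀, u₁))
        (cmLineTensor L e dV hdV hdV0 a ha ha0 Φ₁ Φ₂) =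
      cmLineTensor L e dV hdV hdV0 a ha ha0 (cmLineRep₀ L e e₁ dV hdV hdV0 a ha ha0 hGR hGR₀ hGR₁ η₀ (v, u₀) Φ₁)
        (cmLineRep₁ L e e₁ dV hdV hdV0 a ha ha0 hGR hGR₀ hGR₁ η₁ (v, u₁) Φ₂) := by
  rw [cmPairRepTwist_apply_eq_smul, cmPlaneTorus_apply, cmPairRep_blockDiag_cmLineTensor L e e₁ dV hdV hdV0 a ha ha0
    hGR hGR₀ hGR₁, cmLineRep₀_apply, cmLineRep₁_apply, LinearMap.map_smul₂, LinearMap.map_smul, smul_smul,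
    ← cmPlaneTorus_apply, hη, Units.val_mul]

/-- the see-saw restriction at the DEFAULT split `η₀ := cmEta₀ η` (all of `η`'s `U(V)`-part on the first line),
`η₁ := cmEta₁ η ∘ snd`. [cite: Howe1979, §3; GelbartRogawski1991, §3.1 Remark p. 457 L4–13] -/
theorem cmPairRepTwist_torus_cmLineTensor_default (v : CMAdelic L dV) (u₀ u₁ : CMAdelicOne L)
    (Φ₁ Φ₂ : piSchwartzBruhat (↥(maximalRealSubfield L)) (Fin N × Fin 1)) :
    cmPairRepTwist L e dV hdV hdV0 a ha ha0 hGR η (v, cmPlaneTorus L a (u₀, u₁))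
        (cmLineTensor L e dV hdV hdV0 a ha ha0 Φ₁ Φ₂) =
      cmLineTensor L e dV hdV hdV0 a ha ha0
        (cmLineRep₀ L e e₁ dV hdV hdV0 a ha ha0 hGR hGR₀ hGR₁ (cmEta₀ L dV a η) (v, u₀) Φ₁)
        (cmLineRep₁ L e e₁ dV hdV hdV0 a ha ha0 hGR hGR₀ hGR₁ ((cmEta₁ L dV a η).comp (MonoidHom.snd _ _)) (v, u₁) Φ₂) :=
  cmPairRepTwist_torus_cmLineTensor L e e₁ dV hdV hdV0 a ha ha0 hGR hGR₀ hGR₁ η _ _ (cmEta_torus L dV a η) v u₀ u₁ Φ₁ Φ₂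

end Lines

/-! ## §4. The same in the currencies of the period packet: test functions on `𝒮(𝔸^{n₁})` (re-indexed along
`e₁ : Fin N × Fin 1 ≃ Fin n₁`) and the torus `ker N_{L/L⁺} ≤ 𝔸_L^×` (`relNormOneIdeles`, = `U(1)(𝔸_{L⁺})` by
`cmAdelicOneEquivRelNormOne`) -/

section Fin

variable (L : Type) [Field L] [NumberField L] [IsCMField L] {N n n₁ : ℕ}
  (e : Fin N × Fin 2 ≃ Fin n) (e₁ : Fin N × Fin 1 ≃ Fin n₁)
variable (dV : Fin N → L) (hdV : ∀ i, IsCMField.complexConj L (dV i) = dV i) (hdV0 : ∀ i, dV i ≠ 0)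
variable (a : Fin 2 → L) (ha : ∀ i, IsCMField.complexConj L (a i) = a i) (ha0 : ∀ i, a i ≠ 0)
variable (hGR : (cmSplittingDatum L e dV hdV hdV0 a ha ha0).CompatibleSplitting)
  (hGR₀ : (cmSplittingDatum L e₁ dV hdV hdV0 (lineVec L (a 0)) (fun _ => ha 0) (fun _ => ha0 0)).CompatibleSplitting)
  (hGR₁ : (cmSplittingDatum L e₁ dV hdV hdV0 (lineVec L (a 1)) (fun _ => ha 1) (fun _ => ha0 1)).CompatibleSplitting)
  (η : CMAdelic L dV × CMAdelic L a →* ℂˣ) (η₀ η₁ : CMAdelic L dV × CMAdelicOne L →* ℂˣ)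

/-- **`⊗″` on `𝒮(𝔸^{n₁}) × 𝒮(𝔸^{n₁}) → 𝒮(𝔸^n)`**: `cmLineTensor` precomposed with `R_{e₁}⁻¹` in both variables (bilinear).
[folklore] -/
def cmLineTensorFin :
    piSchwartzBruhat (↥(maximalRealSubfield L)) (Fin n₁) →ₗ[ℂ]
      piSchwartzBruhat (↥(maximalRealSubfield L)) (Fin n₁) →ₗ[ℂ] piSchwartzBruhat (↥(maximalRealSubfield L)) (Fin n) :=
  (cmLineTensor L e dV hdV hdV0 a ha ha0).compl₁₂ (piSBReindex (↥(maximalRealSubfield L)) e₁).symm.toLinearMap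
    (piSBReindex (↥(maximalRealSubfield L)) e₁).symm.toLinearMap

/-- unfolding. [folklore] -/
theorem cmLineTensorFin_apply (φ₁ φ₂ : piSchwartzBruhat (↥(maximalRealSubfield L)) (Fin n₁)) :
    cmLineTensorFin L e e₁ dV hdV hdV0 a ha ha0 φ₁ φ₂ =
      cmLineTensor L e dV hdV hdV0 a ha ha0 ((piSBReindex (↥(maximalRealSubfield L)) e₁).symm φ₁)
        ((piSBReindex (↥(maximalRealSubfield L)) e₁).symm φ₂) :=
  rfl

/-- **`Θ(φ₁ ⊗″ φ₂) = Θ(φ₁) · Θ(φ₂)`** in the `Fin n₁` currency (the `prod` hypothesis of `SeesawCore.ofOp`).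
[cite: Weil1964, Chap. III n° 41 Thm 6 p. 193] -/
theorem thetaDistLM_cmLineTensorFin (φ₁ φ₂ : piSchwartzBruhat (↥(maximalRealSubfield L)) (Fin n₁)) :
    thetaDistLM (↥(maximalRealSubfield L)) (Fin n) (cmLineTensorFin L e e₁ dV hdV hdV0 a ha ha0 φ₁ φ₂) =
      thetaDistLM (↥(maximalRealSubfield L)) (Fin n₁) φ₁ * thetaDistLM (↥(maximalRealSubfield L)) (Fin n₁) φ₂ := by
  rw [cmLineTensorFin_apply, thetaDistLM_cmLineTensor, piSBReindex_symm, thetaDistLM_piSBReindex,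
    thetaDistLM_piSBReindex]

/-- **`cmLineRepFin₀`**: `cmLineRep₀ η₀` on `U(diag dV)(𝔸) × ker N_{L/L⁺}` acting on `𝒮(𝔸^{n₁})` (torus through
`cmAdelicOneEquivRelNormOne⁻¹`, model through `R_{e₁}`). [cite: GelbartRogawski1991, §3.1 Remark p. 457 L4–13] -/
def cmLineRepFin₀ :
    Representation ℂ (CMAdelic L dV × ↥(relNormOneIdeles (↥(maximalRealSubfield L)) L))
      (piSchwartzBruhat (↥(maximalRealSubfield L)) (Fin n₁)) :=
  (piSBReindex (↥(maximalRealSubfield L)) e₁).conjRingEquiv.toMonoidHom.comp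
    ((cmLineRep₀ L e e₁ dV hdV hdV0 a ha ha0 hGR hGR₀ hGR₁ η₀).comp
      ((MonoidHom.id _).prodMap (cmAdelicOneEquivRelNormOne L).symm.toMonoidHom))

/-- **`cmLineRepFin₁`**: `cmLineRep₁ η₁` in the same currencies. [cite: GelbartRogawski1991, §3.1 Remark p. 457 L4–13] -/
def cmLineRepFin₁ :
    Representation ℂ (CMAdelic L dV × ↥(relNormOneIdeles (↥(maximalRealSubfield L)) L))
      (piSchwartzBruhat (↥(maximalRealSubfield L)) (Fin n₁)) :=
  (piSBReindex (↥(maximalRealSubfield L)) e₁).conjRingEquiv.toMonoidHom.comp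
    ((cmLineRep₁ L e e₁ dV hdV hdV0 a ha ha0 hGR hGR₀ hGR₁ η₁).comp
      ((MonoidHom.id _).prodMap (cmAdelicOneEquivRelNormOne L).symm.toMonoidHom))

/-- values of `cmLineRepFin₀`: `R_{e₁} (cmLineRep₀ η₀ (v, t) (R_{e₁}⁻¹ φ))`. [folklore] -/
theorem cmLineRepFin₀_apply (v : CMAdelic L dV) (t : ↥(relNormOneIdeles (↥(maximalRealSubfield L)) L))
    (φ : piSchwartzBruhat (↥(maximalRealSubfield L)) (Fin n₁)) :
    cmLineRepFin₀ L e e₁ dV hdV hdV0 a ha ha0 hGR hGR₀ hGR₁ η₀ (v, t) φ =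
      piSBReindex (↥(maximalRealSubfield L)) e₁
        (cmLineRep₀ L e e₁ dV hdV hdV0 a ha ha0 hGR hGR₀ hGR₁ η₀ (v, (cmAdelicOneEquivRelNormOne L).symm t)
          ((piSBReindex (↥(maximalRealSubfield L)) e₁).symm φ)) :=
  rfl

/-- values of `cmLineRepFin₁`. [folklore] -/
theorem cmLineRepFin₁_apply (v : CMAdelic L dV) (t : ↥(relNormOneIdeles (↥(maximalRealSubfield L)) L))
    (φ : piSchwartzBruhat (↥(maximalRealSubfield L)) (Fin n₁)) :
    cmLineRepFin₁ L e e₁ dV hdV hdV0 a ha ha0 hGR hGR₀ hGR₁ η₁ (v, t) φ =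
      piSBReindex (↥(maximalRealSubfield L)) e₁
        (cmLineRep₁ L e e₁ dV hdV hdV0 a ha ha0 hGR hGR₀ hGR₁ η₁ (v, (cmAdelicOneEquivRelNormOne L).symm t)
          ((piSBReindex (↥(maximalRealSubfield L)) e₁).symm φ)) :=
  rfl

/-- **the plane's torus element of a pair of norm-one ideles** `(t₀, t₁) ↦ diag(t₀, t₁) ∈ U(diag(a₀,a₁))(𝔸)`. [cite: Kudla1984, §1] -/
def cmPlaneTorusIdeles :
    ↥(relNormOneIdeles (↥(maximalRealSubfield L)) L) × ↥(relNormOneIdeles (↥(maximalRealSubfield L)) L) →* CMAdelic L a :=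
  (cmPlaneTorus L a).comp
    ((cmAdelicOneEquivRelNormOne L).symm.toMonoidHom.prodMap (cmAdelicOneEquivRelNormOne L).symm.toMonoidHom)

/-- unfolding. [folklore] -/
theorem cmPlaneTorusIdeles_apply (t₀ t₁ : ↥(relNormOneIdeles (↥(maximalRealSubfield L)) L)) :
    cmPlaneTorusIdeles L a (t₀, t₁) =
      cmPlaneTorus L a ((cmAdelicOneEquivRelNormOne L).symm t₀, (cmAdelicOneEquivRelNormOne L).symm t₁) :=
  rfl

/-- its matrix is `diagonal ![t₀, t₁]`. [cite: Kudla1984, §1] -/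
theorem val_cmPlaneTorusIdeles (t₀ t₁ : ↥(relNormOneIdeles (↥(maximalRealSubfield L)) L)) :
    (((cmPlaneTorusIdeles L a (t₀, t₁) : CMAdelic L a) : GL (Fin (1 + 1)) (AdeleRing (𝓞 L) L)) :
        Matrix (Fin (1 + 1)) (Fin (1 + 1)) (AdeleRing (𝓞 L) L)) =
      Matrix.diagonal ![((t₀ : (AdeleRing (𝓞 L) L)ˣ) : AdeleRing (𝓞 L) L), ((t₁ : (AdeleRing (𝓞 L) L)ˣ) : AdeleRing (𝓞 L) L)] :=
  val_cmPlaneTorus L a _ _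

/-- **THE SEE-SAW RESTRICTION, period-packet currencies**: for every split `η(v, diag(t₀,t₁)) = η₀(v,t₀) · η₁(v,t₁)`
(stated on `U(1)(𝔸)`), `v ∈ U(diag dV)(𝔸)`, norm-one ideles `t₀, t₁` and `φ₁, φ₂ ∈ 𝒮(𝔸^{n₁})`,
`(ω_ψ ∘ (s_pair ⊗ η))(v, diag(t₀, t₁)) (φ₁ ⊗″ φ₂) = (cmLineRepFin₀ η₀ (v, t₀) φ₁) ⊗″ (cmLineRepFin₁ η₁ (v, t₁) φ₂)`.
[cite: Howe1979, §3; GelbartRogawski1991, §3.1 Remark p. 457 L4–13] -/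
theorem cmPairRepTwist_torusIdeles_cmLineTensorFin
    (hη : ∀ (v : CMAdelic L dV) (u₀ u₁ : CMAdelicOne L), η (v, cmPlaneTorus L a (u₀, u₁)) = η₀ (v, u₀) * η₁ (v, u₁))
    (v : CMAdelic L dV) (t₀ t₁ : ↥(relNormOneIdeles (↥(maximalRealSubfield L)) L))
    (φ₁ φ₂ : piSchwartzBruhat (↥(maximalRealSubfield L)) (Fin n₁)) :
    cmPairRepTwist L e dV hdV hdV0 a ha ha0 hGR η (v, cmPlaneTorusIdeles L a (t₀, t₁))
        (cmLineTensorFin L e e₁ dV hdV hdV0 a ha ha0 φ₁ φ₂) =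
      cmLineTensorFin L e e₁ dV hdV hdV0 a ha ha0 (cmLineRepFin₀ L e e₁ dV hdV hdV0 a ha ha0 hGR hGR₀ hGR₁ η₀ (v, t₀) φ₁)
        (cmLineRepFin₁ L e e₁ dV hdV hdV0 a ha ha0 hGR hGR₀ hGR₁ η₁ (v, t₁) φ₂) := by
  rw [cmLineTensorFin_apply, cmLineTensorFin_apply, cmLineRepFin₀_apply, cmLineRepFin₁_apply,
    LinearEquiv.symm_apply_apply, LinearEquiv.symm_apply_apply]
  exact cmPairRepTwist_torus_cmLineTensor L e e₁ dV hdV hdV0 a ha ha0 hGR hGR₀ hGR₁ η η₀ η₁ hη v _ _ _ _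

/-- the same at the DEFAULT split `η₀ := cmEta₀ η`, `η₁ := cmEta₁ η ∘ snd`.
[cite: Howe1979, §3; GelbartRogawski1991, §3.1 Remark p. 457 L4–13] -/
theorem cmPairRepTwist_torusIdeles_cmLineTensorFin_default (v : CMAdelic L dV)
    (t₀ t₁ : ↥(relNormOneIdeles (↥(maximalRealSubfield L)) L))
    (φ₁ φ₂ : piSchwartzBruhat (↥(maximalRealSubfield L)) (Fin n₁)) :
    cmPairRepTwist L e dV hdV hdV0 a ha ha0 hGR η (v, cmPlaneTorusIdeles L a (t₀, t₁))
        (cmLineTensorFin L e e₁ dV hdV hdV0 a ha ha0 φ₁ φ₂) =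
      cmLineTensorFin L e e₁ dV hdV hdV0 a ha ha0
        (cmLineRepFin₀ L e e₁ dV hdV hdV0 a ha ha0 hGR hGR₀ hGR₁ (cmEta₀ L dV a η) (v, t₀) φ₁)
        (cmLineRepFin₁ L e e₁ dV hdV hdV0 a ha ha0 hGR hGR₀ hGR₁ ((cmEta₁ L dV a η).comp (MonoidHom.snd _ _)) (v, t₁) φ₂) :=
  cmPairRepTwist_torusIdeles_cmLineTensorFin L e e₁ dV hdV hdV0 a ha ha0 hGR hGR₀ hGR₁ η _ _ (cmEta_torus L dV a η) v t₀ t₁ φ₁ φ₂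

end Fin

/-! ## §5. The raw line representations fix `Θ` on rational points -/

section Rational

variable (L : Type) [Field L] [NumberField L] [IsCMField L] {N n n₁ : ℕ}
  (e : Fin N × Fin 2 ≃ Fin n) (e₁ : Fin N × Fin 1 ≃ Fin n₁)
variable (dV : Fin N → L) (hdV : ∀ i, IsCMField.complexConj L (dV i) = dV i) (hdV0 : ∀ i, dV i ≠ 0)
variable (a : Fin 2 → L) (ha : ∀ i, IsCMField.complexConj L (a i) = a i) (ha0 : ∀ i, a i ≠ 0)
variable (hGR : (cmSplittingDatum L e dV hdV hdV0 a ha ha0).CompatibleSplitting)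
  (hGR₀ : (cmSplittingDatum L e₁ dV hdV hdV0 (lineVec L (a 0)) (fun _ => ha 0) (fun _ => ha0 0)).CompatibleSplitting)
  (hGR₁ : (cmSplittingDatum L e₁ dV hdV hdV0 (lineVec L (a 1)) (fun _ => ha 1) (fun _ => ha0 1)).CompatibleSplitting)

/-- the rational conjugator `1` is an isometry `diag(a₀, a₁) → ⟨a₀⟩ ⊕ ⟨a₁⟩`. [folklore] -/
theorem ratIsometry_one_lineVec :
    (((1 : GL (Fin (1 + 1)) L) : Matrix (Fin (1 + 1)) (Fin (1 + 1)) L).map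
          (IsCMField.complexConj L : L →+* L))ᵀ * Matrix.diagonal a * ((1 : GL (Fin (1 + 1)) L) : Matrix (Fin (1 + 1)) (Fin (1 + 1)) L) =
      finSum 1 1 (Matrix.diagonal (lineVec L (a 0))) (Matrix.diagonal (lineVec L (a 1))) := by
  rw [finSum_diagonal_lineVec, Units.val_one, Matrix.map_one _ (map_zero _) (map_one _), Matrix.transpose_one, one_mul,
    mul_one]

/-- **`ω₀″(γ_U, γ)` fixes `Θ`** for rational `γ_U ∈ U(diag dV)(L⁺)`, `γ ∈ U(⟨a₀⟩)(L⁺)`.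
[cite: Weil1964, Chap. III n° 41 Thm 6 p. 193] -/
theorem cmLineRepRaw₀_toHomUnits_mem_thetaStabilizer {v : CMAdelic L dV} (hv : v ∈ CMRat L dV)
    {u : CMAdelic L (lineVec L (a 0))} (hu : u ∈ CMRat L (lineVec L (a 0))) :
    (cmLineRepRaw₀ L e e₁ dV hdV hdV0 a ha ha0 hGR hGR₀ hGR₁).toHomUnits (v, u) ∈
      thetaStabilizer (↥(maximalRealSubfield L)) (Fin N × Fin 1) :=
  seesawConjRep₁_toHomUnits_mem_thetaStabilizer (↥(maximalRealSubfield L)) L (IsCMField.complexConj L) N 1 1 e e₁ e₁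
    (Matrix.diagonal dV) (Matrix.diagonal a) (Matrix.diagonal (lineVec L (a 0))) (Matrix.diagonal (lineVec L (a 1)))
    (complexConj_imagUnit L) (imagUnit_ne_zero L) (imagUnit_mul_self L)
    (realDiagonal_isSymm L dV hdV) (realDiagonal_isSymm L a ha)
    (realDiagonal_isSymm L (lineVec L (a 0)) fun _ => ha 0) (realDiagonal_isSymm L (lineVec L (a 1)) fun _ => ha 1)
    (isUnit_det_realDiagonal L dV hdV hdV0) (isUnit_det_realDiagonal L a ha ha0)
    (isUnit_det_realDiagonal L (lineVec L (a 0)) (fun _ => ha 0) fun _ => ha0 0)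
    (isUnit_det_realDiagonal L (lineVec L (a 1)) (fun _ => ha 1) fun _ => ha0 1)
    ((Matrix.isUnit_iff_isUnit_det _).1
      (isUnit_kronecker_map (↥(maximalRealSubfield L)) N (isUnit_det_realDiagonal L dV hdV hdV0)
        (isUnit_det_realDiagonal L a ha ha0)))
    (realDiagonal_map L dV hdV).symm (realDiagonal_map L a ha).symm
    (realDiagonal_map L (lineVec L (a 0)) fun _ => ha 0).symm (realDiagonal_map L (lineVec L (a 1)) fun _ => ha 1).symm
    (coe_one_GL_eq_map L (AdeleRing (𝓞 L) L) (Fin (1 + 1))) (adelicIsometry_one_lineVec L a)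
    (coe_one_GL_eq_map (↥(maximalRealSubfield L)) (AdeleRing (𝓞 ↥(maximalRealSubfield L)) ↥(maximalRealSubfield L))
      (Fin N × Fin (1 + 1)))
    (gramIntertwiner_one_lineVec L a ha (realDiagonal L dV hdV))
    (splittingOf_isCompatible _ _ _ _ _ _ _ _ _ _ _ _ _ _ _ _ _ hGR)
    (splittingOf_isCompatible _ _ _ _ _ _ _ _ _ _ _ _ _ _ _ _ _ hGR₀)
    (splittingOf_isCompatible _ _ _ _ _ _ _ _ _ _ _ _ _ _ _ _ _ hGR₁) (ratIsometry_one_lineVec L a) hv hu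

/-- **`ω₁″(γ_U, γ)` fixes `Θ`** for rational `γ_U ∈ U(diag dV)(L⁺)`, `γ ∈ U(⟨a₁⟩)(L⁺)`.
[cite: Weil1964, Chap. III n° 41 Thm 6 p. 193] -/
theorem cmLineRepRaw₁_toHomUnits_mem_thetaStabilizer {v : CMAdelic L dV} (hv : v ∈ CMRat L dV)
    {u : CMAdelic L (lineVec L (a 1))} (hu : u ∈ CMRat L (lineVec L (a 1))) :
    (cmLineRepRaw₁ L e e₁ dV hdV hdV0 a ha ha0 hGR hGR₀ hGR₁).toHomUnits (v, u) ∈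
      thetaStabilizer (↥(maximalRealSubfield L)) (Fin N × Fin 1) :=
  seesawConjRep₂_toHomUnits_mem_thetaStabilizer (↥(maximalRealSubfield L)) L (IsCMField.complexConj L) N 1 1 e e₁ e₁
    (Matrix.diagonal dV) (Matrix.diagonal a) (Matrix.diagonal (lineVec L (a 0))) (Matrix.diagonal (lineVec L (a 1)))
    (complexConj_imagUnit L) (imagUnit_ne_zero L) (imagUnit_mul_self L)
    (realDiagonal_isSymm L dV hdV) (realDiagonal_isSymm L a ha)
    (realDiagonal_isSymm L (lineVec L (a 0)) fun _ => ha 0) (realDiagonal_isSymm L (lineVec L (a 1)) fun _ => ha 1)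
    (isUnit_det_realDiagonal L dV hdV hdV0) (isUnit_det_realDiagonal L a ha ha0)
    (isUnit_det_realDiagonal L (lineVec L (a 0)) (fun _ => ha 0) fun _ => ha0 0)
    (isUnit_det_realDiagonal L (lineVec L (a 1)) (fun _ => ha 1) fun _ => ha0 1)
    ((Matrix.isUnit_iff_isUnit_det _).1
      (isUnit_kronecker_map (↥(maximalRealSubfield L)) N (isUnit_det_realDiagonal L dV hdV hdV0)
        (isUnit_det_realDiagonal L a ha ha0)))
    (realDiagonal_map L dV hdV).symm (realDiagonal_map L a ha).symm
    (realDiagonal_map L (lineVec L (a 0)) fun _ => ha 0).symm (realDiagonal_map L (lineVec L (a 1)) fun _ => ha 1).symm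
    (coe_one_GL_eq_map L (AdeleRing (𝓞 L) L) (Fin (1 + 1))) (adelicIsometry_one_lineVec L a)
    (coe_one_GL_eq_map (↥(maximalRealSubfield L)) (AdeleRing (𝓞 ↥(maximalRealSubfield L)) ↥(maximalRealSubfield L))
      (Fin N × Fin (1 + 1)))
    (gramIntertwiner_one_lineVec L a ha (realDiagonal L dV hdV))
    (splittingOf_isCompatible _ _ _ _ _ _ _ _ _ _ _ _ _ _ _ _ _ hGR)
    (splittingOf_isCompatible _ _ _ _ _ _ _ _ _ _ _ _ _ _ _ _ _ hGR₀)
    (splittingOf_isCompatible _ _ _ _ _ _ _ _ _ _ _ _ _ _ _ _ _ hGR₁) (ratIsometry_one_lineVec L a) hv hu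

end Rational

/-! ## §6 Junction with the `adelicUnitaryGroup` currency (the period packet's torus embedding) -/

section Junction

variable (L : Type) [Field L] [NumberField L] [IsCMField L] {N n n₁ : ℕ}
  (e : Fin N × Fin 2 ≃ Fin n) (e₁ : Fin N × Fin 1 ≃ Fin n₁)
variable (dV : Fin N → L) (hdV : ∀ i, IsCMField.complexConj L (dV i) = dV i) (hdV0 : ∀ i, dV i ≠ 0)
variable (a : Fin 2 → L) (ha : ∀ i, IsCMField.complexConj L (a i) = a i) (ha0 : ∀ i, a i ≠ 0)
variable (hGR : (cmSplittingDatum L e dV hdV hdV0 a ha ha0).CompatibleSplitting)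
variable (hGR₀ : (cmSplittingDatum L e₁ dV hdV hdV0 (lineVec L (a 0)) (fun _ => ha 0) (fun _ => ha0 0)).CompatibleSplitting)
variable (hGR₁ : (cmSplittingDatum L e₁ dV hdV hdV0 (lineVec L (a 1)) (fun _ => ha 1) (fun _ => ha0 1)).CompatibleSplitting)
variable (η : CMAdelic L dV × CMAdelic L a →* ℂˣ) (η₀ η₁ : CMAdelic L dV × CMAdelicOne L →* ℂˣ)

/-- **Junction**: an element `x ∈ U(diag a)(𝔸_{L⁺})` (the `adelicUnitaryGroup` currency of `AdelicUnitaryGroup`) whose matrix is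
`diag(t₀, t₁)` for norm-one ideles `t₀, t₁` is carried by the CM carrier bridge `cmAdelicEquiv` (the identity on matrices) to
`cmPlaneTorusIdeles (t₀, t₁)`.  (Consumer: the period packet's torus embedding `T(𝔸) → U(W)(𝔸)`, `t ↦ diag(t₀, t₁)`, whose defining
property is exactly the hypothesis `hx`.) [folklore] -/
theorem cmAdelicEquiv_eq_cmPlaneTorusIdeles (x : ↥(adelicUnitaryGroup L (Matrix.diagonal a)))
    (t₀ t₁ : ↥(relNormOneIdeles (↥(maximalRealSubfield L)) L))
    (hx : ((x : GL (Fin 2) (AdeleRing (𝓞 L) L)) : Matrix (Fin 2) (Fin 2) (AdeleRing (𝓞 L) L)) =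
      Matrix.diagonal ![((t₀ : (AdeleRing (𝓞 L) L)ˣ) : AdeleRing (𝓞 L) L), ((t₁ : (AdeleRing (𝓞 L) L)ˣ) : AdeleRing (𝓞 L) L)]) :
    cmAdelicEquiv L 2 (Matrix.diagonal a) x = cmPlaneTorusIdeles L a (t₀, t₁) :=
  Subtype.ext (Units.ext (hx.trans (val_cmPlaneTorusIdeles L a t₀ t₁).symm))

/-- the same, read through `MonoidHom`s: for a hom `j : T →* U(diag a)(𝔸)` with matrices `diag(t₀ t, t₁ t)`,
`cmAdelicEquiv ∘ j = cmPlaneTorusIdeles ∘ (t₀, t₁)`. [folklore] -/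
theorem cmAdelicEquiv_comp_eq_cmPlaneTorusIdeles {T : Type*} [Monoid T] (j : T →* ↥(adelicUnitaryGroup L (Matrix.diagonal a)))
    (t₀ t₁ : T →* ↥(relNormOneIdeles (↥(maximalRealSubfield L)) L))
    (hj : ∀ t : T, ((j t : GL (Fin 2) (AdeleRing (𝓞 L) L)) : Matrix (Fin 2) (Fin 2) (AdeleRing (𝓞 L) L)) =
      Matrix.diagonal ![((t₀ t : (AdeleRing (𝓞 L) L)ˣ) : AdeleRing (𝓞 L) L), ((t₁ t : (AdeleRing (𝓞 L) L)ˣ) : AdeleRing (𝓞 L) L)])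
    (t : T) :
    (cmAdelicEquiv L 2 (Matrix.diagonal a)).toMonoidHom.comp j t = cmPlaneTorusIdeles L a (t₀ t, t₁ t) :=
  cmAdelicEquiv_eq_cmPlaneTorusIdeles L a (j t) (t₀ t) (t₁ t) (hj t)

/-- **THE SEE-SAW RESTRICTION along the torus embedding of the period packet**: for `x = diag(t₀, t₁) ∈ U(diag a)(𝔸_{L⁺})`
(in the `adelicUnitaryGroup` currency), `v ∈ U(diag dV)(𝔸)` and `φ₁, φ₂ ∈ 𝒮(𝔸^{n₁})`,
`(ω_ψ ∘ (s_pair ⊗ η))(v, cmAdelicEquiv x) (φ₁ ⊗″ φ₂) = (cmLineRepFin₀ η₀ (v, t₀) φ₁) ⊗″ (cmLineRepFin₁ η₁ (v, t₁) φ₂)`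
(`cmPairRepTwist_torusIdeles_cmLineTensorFin` transported by `cmAdelicEquiv_eq_cmPlaneTorusIdeles`).
[cite: Howe1979, §3; GelbartRogawski1991, §3.1 Remark p. 457 L4–13] -/
theorem cmPairRepTwist_cmAdelicEquiv_cmLineTensorFin
    (hη : ∀ (v : CMAdelic L dV) (u₀ u₁ : CMAdelicOne L), η (v, cmPlaneTorus L a (u₀, u₁)) = η₀ (v, u₀) * η₁ (v, u₁))
    (v : CMAdelic L dV) (x : ↥(adelicUnitaryGroup L (Matrix.diagonal a)))
    (t₀ t₁ : ↥(relNormOneIdeles (↥(maximalRealSubfield L)) L))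
    (hx : ((x : GL (Fin 2) (AdeleRing (𝓞 L) L)) : Matrix (Fin 2) (Fin 2) (AdeleRing (𝓞 L) L)) =
      Matrix.diagonal ![((t₀ : (AdeleRing (𝓞 L) L)ˣ) : AdeleRing (𝓞 L) L), ((t₁ : (AdeleRing (𝓞 L) L)ˣ) : AdeleRing (𝓞 L) L)])
    (φ₁ φ₂ : piSchwartzBruhat (↥(maximalRealSubfield L)) (Fin n₁)) :
    cmPairRepTwist L e dV hdV hdV0 a ha ha0 hGR η (v, cmAdelicEquiv L 2 (Matrix.diagonal a) x)
        (cmLineTensorFin L e e₁ dV hdV hdV0 a ha ha0 φ₁ φ₂) =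
      cmLineTensorFin L e e₁ dV hdV hdV0 a ha ha0
        (cmLineRepFin₀ L e e₁ dV hdV hdV0 a ha ha0 hGR hGR₀ hGR₁ η₀ (v, t₀) φ₁)
        (cmLineRepFin₁ L e e₁ dV hdV hdV0 a ha ha0 hGR hGR₀ hGR₁ η₁ (v, t₁) φ₂) := by
  rw [cmAdelicEquiv_eq_cmPlaneTorusIdeles L a x t₀ t₁ hx]
  exact cmPairRepTwist_torusIdeles_cmLineTensorFin L e e₁ dV hdV hdV0 a ha ha0 hGR hGR₀ hGR₁ η η₀ η₁ hη v t₀ t₁ φ₁ φ₂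

/-- default instance of `cmPairRepTwist_cmAdelicEquiv_cmLineTensorFin` (`η₀ := cmEta₀ η`, `η₁ := cmEta₁ η ∘ pr₂`). [folklore] -/
theorem cmPairRepTwist_cmAdelicEquiv_cmLineTensorFin_default
    (v : CMAdelic L dV) (x : ↥(adelicUnitaryGroup L (Matrix.diagonal a)))
    (t₀ t₁ : ↥(relNormOneIdeles (↥(maximalRealSubfield L)) L))
    (hx : ((x : GL (Fin 2) (AdeleRing (𝓞 L) L)) : Matrix (Fin 2) (Fin 2) (AdeleRing (𝓞 L) L)) =
      Matrix.diagonal ![((t₀ : (AdeleRing (𝓞 L) L)ˣ) : AdeleRing (𝓞 L) L), ((t₁ : (AdeleRing (𝓞 L) L)ˣ) : AdeleRing (𝓞 L) L)])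
    (φ₁ φ₂ : piSchwartzBruhat (↥(maximalRealSubfield L)) (Fin n₁)) :
    cmPairRepTwist L e dV hdV hdV0 a ha ha0 hGR η (v, cmAdelicEquiv L 2 (Matrix.diagonal a) x)
        (cmLineTensorFin L e e₁ dV hdV hdV0 a ha ha0 φ₁ φ₂) =
      cmLineTensorFin L e e₁ dV hdV hdV0 a ha ha0
        (cmLineRepFin₀ L e e₁ dV hdV hdV0 a ha ha0 hGR hGR₀ hGR₁ (cmEta₀ L dV a η) (v, t₀) φ₁)
        (cmLineRepFin₁ L e e₁ dV hdV hdV0 a ha ha0 hGR hGR₀ hGR₁ ((cmEta₁ L dV a η).comp (MonoidHom.snd _ _)) (v, t₁) φ₂) := by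
  rw [cmAdelicEquiv_eq_cmPlaneTorusIdeles L a x t₀ t₁ hx]
  exact cmPairRepTwist_torusIdeles_cmLineTensorFin_default L e e₁ dV hdV hdV0 a ha ha0 hGR hGR₀ hGR₁ η v t₀ t₁ φ₁ φ₂

end Junction

/-! ### Build-lane note (ops-buildfix G11b-3 recipe, LEDGER B13-1, 2026-08-21)
`lean -o` (the hub build lane, never `lean`/the gate check) runs Lean 4.32's library-suggestion indexers
(`Lean.LibrarySuggestions.SymbolFrequency` / `SineQuaNon`, from their `exportEntriesFn`) over the statement of
every local theorem that is not a denied premise; on this family's statements (very large dependent binder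
telescopes through the theta-kernel / dual-pair data) that fold runs for tens of minutes to hours and the build
lane kills the job (incident G11b-3, run/shared/lean/ops/buildfix/G11b-3-DOSSIER.md). `isDeniedPremise` skips
`[implicit_reducible]` constants before any fold, and a reducibility status on a *theorem* is inert (Meta never
unfolds `thmInfo`; the kernel ignores the attribute), so the public theorems of this file are tagged
`[implicit_reducible]` purely to keep them out of that index. Only other effect: they are not offered by
`+suggestions` premise selectors. No statement or proof is changed; superseded if the operator lands a
deny-list form (`HarnessLib.PremiseIndex`). -/
set_option allowUnsafeReducibility true in
attribute [implicit_reducible]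
  finSum_diagonal_lineVec finSum_realDiagonal_lineVec coe_one_GL_eq_map adelicIsometry_one_lineVec
  gramIntertwiner_one_lineVec cmPairRep_blockDiag_cmLineTensor thetaDistLM_cmLineTensor
  cmPlaneTorus_apply coe_cmPlaneTorus val_cmPlaneTorus cmPlaneTorus_eq_inl_mul_inr cmEta_torus
  cmLineRep₀_apply cmLineRep₁_apply cmPairRepTwist_torus_cmLineTensor
  cmPairRepTwist_torus_cmLineTensor_default cmLineTensorFin_apply thetaDistLM_cmLineTensorFin
  cmLineRepFin₀_apply cmLineRepFin₁_apply cmPlaneTorusIdeles_apply val_cmPlaneTorusIdeles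
  cmPairRepTwist_torusIdeles_cmLineTensorFin cmPairRepTwist_torusIdeles_cmLineTensorFin_default
  ratIsometry_one_lineVec cmLineRepRaw₀_toHomUnits_mem_thetaStabilizer
  cmLineRepRaw₁_toHomUnits_mem_thetaStabilizer cmAdelicEquiv_eq_cmPlaneTorusIdeles
  cmAdelicEquiv_comp_eq_cmPlaneTorusIdeles cmPairRepTwist_cmAdelicEquiv_cmLineTensorFin
  cmPairRepTwist_cmAdelicEquiv_cmLineTensorFin_default

end UnitaryDualPair

end Literature.NumberTheory.GelbartRogawski1991

end
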